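import Summits.Ventures.YMGap.BEDoor.Approx
import Summits.Ventures.YMGap.Thresholds.LatticeBakryEmeryPolarisation
import Summits.Ventures.YMGap.Thresholds.LatticeBakryEmeryC2Density

/-!
# BEDoor / FormatInputs — §5, §5b, §4e the door's three INPUTS from format data — Cauchy (strip bound ⇒ `HessBoundOn`), polarisation (⇒ `OffDiagHessBound`), C²-density (`ContDiff ⇒ C2PolyApprox`) — the last two as ADAPTERS to the tree's `Thresholds/LatticeBakryEmery{Polarisation,C2Density}`
# (module 06/11 of the Bakry–Émery door, LIFT edition v8.3 = parts `Exch2` (v8.2 module 08), `Polarisation` (v8.2 module 09), `C2Density` (v8.2 module 10); cell `ym-beyond`, seat P4)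

HONEST FRAMING (cell `ym-beyond`, seat P4 «Hessian-currency receiver», lens Y2; HUMAN RULINGS D-0035 / D-0037; memo `HOME/ROUTE-P4Y2.md` v8.1 +
g10 addendum, spec `HOME/ROUTE-P4Y2-LIFT-SPEC-v83.md`; LIFT edition v8.3 = the v8.2 module bodies of `HOME/ROUTE-P4Y2-Sketch.lean` v8.1, byte-identical and in
order, re-packed into 11 ≤ 400-line modules (fewer olean round-trips; director-ym line №2 (B)); the g10 appendix `OpenStrip` is a separate, UNQUEUED HOME file (line №3 (D))).  FINITE-LATTICE
statements at STRONG effective coupling: a RECEIVER («door») in HESSIAN (Bakry–Émery) currency for renormalisation-group output, typed over the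
tree's generic clustering chain `Thresholds/SharpClustering*` + `Thresholds/LatticeBakryEmery*`, complementary to the Dobrushin-currency door
`YM4Door/*` (LITERALLY the same INPUT predicate `QuasiLocalGaugePerturbation.HasAnalyticNormLE … stripDomain`, the same OUTPUT predicate
`RobustBall.ClustersWith`; no residual hypothesis: Osgood regularity is the tree's `Literature.Analysis.Complex.SCV.contDiffOn_infty`,
part `Osgood` of module `AnalyticStrip`).  Nothing here is a statement about `β → ∞`, the continuum limit or the Clay problem; NO effective action is asserted to be at
the door (that INPUT is not in print for `d = 4`); the verdict «the two windows do not meet» is unchanged in this currency.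
WHAT THIS IS NOT (ladder rung R2d; director-ym line №2 (B)): every door of this LIFT is an entry on the STRONG-COUPLING BANK of THE NUMBER —
finite-lattice exponential clustering at SMALL `|β|` and small strip norm `η` of the perturbation (`SU(2)`, `d = 4`: `16.2|β| + 4.4η < 1`, module `SU2`,
conclusion literally `RobustBall.ClustersWith`) — NOT clustering at weak coupling, NOT a statement at large `β`, NOT the mass gap.
No conjecture name, no `sorry`, no axiom beyond the standard three; every theorem is bookkeeping over the tree. [folklore]
References: H. Shen, R. Zhu, X. Zhu, CMP 400 (2023) 805 (arXiv:2204.12737) Thm 1.2, Cor. 4.4/4.11; D. Bakry, M. Émery, LNM 1123 (1985);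
T. Bałaban, CMP 109 (1987) 249, (1.18)–(1.22) (analyticity format); L. Hörmander, An Introduction to Complex Analysis in Several Variables
(1973) Thm 2.2.1/2.2.6 (Osgood); E. J. McShane, Bull. AMS 40 (1934) 837 (Lipschitz extension).

THIS MODULE, part `Exch2` (§5 EXCH-2: Bałaban's analyticity FORMAT ⇒ Hessian currency (Cauchy's estimate)): `frobNorm_real_smul`, `algD_algD_smul_dir`
(homogeneity `D_{cV}D_{cV} = c²D_VD_V`), `StripBoundOn F X M r` (along every right flow supported on `X` with `Σ‖V_e‖² ≤ 1` the activity extends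
`DiffContOnCl` to the complex disc of radius `r`, bounded by `M` on the circle), ★★ `hessBoundOn_of_stripBoundOn` (`⇒ HessBoundOn F X (2M/r²)`,
Mathlib `norm_iteratedDeriv_le_of_forall_mem_sphere_norm_le`).  NOTE: `algD_algD_smul_dir` is also in the tree's
`Thresholds/LatticeBakryEmeryPolarisation.lean` (landed from this cell); the copy here is shadowed-safe (namespace priority) and may be deleted by the
filer.

THIS MODULE, part `Polarisation` (§5b both door inputs from ONE strip datum, over the tree's `Thresholds/LatticeBakryEmeryPolarisation.lean`):
`offDiagHessBound_of_stripBoundOn` — `StripBoundOn F X M r ⇒ OffDiagHessBound F (4M/r²·1_{e,e'∈X})`, from `hessBoundOn_of_stripBoundOn` (module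
`Exch2`) and the tree's polarisation lemma `LatticeBakryEmery.offDiagHessBound_of_hessBoundOn`.

THIS MODULE, part `C2Density` (§4e D1 as an ADAPTER to the tree's `Thresholds/LatticeBakryEmeryC2Density.lean`): ★★★ `c2PolyApprox_of_contDiff :
ContDiff ℝ ∞ S → C2PolyApprox S` — C²-Weierstrass on `SU(N)^ι` in the tree's currency (sup, `HessBound`, `OffDiagHessBound`), read off the tree
theorem `LatticeBakryEmery.c2PolyApprox_of_contDiff` (group convolution with polynomial approximate identities; landed from this cell's
`LIFT-P4Y2-LatticeBakryEmeryC2Density.lean`).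
-/

noncomputable section

open scoped Matrix ComplexConjugate BigOperators Matrix.Norms.Frobenius ContDiff Topology
open Matrix Complex Finset MeasureTheory Filter
open Literature.MathematicalPhysics.QuantumFieldTheory
open Literature.MathematicalPhysics.QuantumFieldTheory.SUNBakryEmery (SUN FrameIdx frame)

namespace Summit.Ventures.YMGap.BEDoor

open Summit.Ventures.YMGap Summit.Ventures.YMGap.LatticeBakryEmery Summit.Ventures.YMGap.SharpClustering
open Summit.Ventures.YMGap.HessianSharp

universe u

/-! ## ── part 08 · `Exch2` — §5 EXCH-2: Bałaban's analyticity FORMAT ⇒ Hessian currency (Cauchy's estimate) ── -/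

/-! ## §5 EXCH-2 TYPED (PROVED): Bałaban's analyticity format ⇒ the Hessian currency, by Cauchy's estimate
A local term of an effective action is real-analytic: along every one-parameter subgroup `s ↦ Q·e^{sV}` it extends to a
complex-differentiable function of `s` on a disc of radius `r`, bounded by `M` (for `V` Hilbert–Schmidt-normalised on the
localisation domain `X`).  Cauchy's estimate for the second derivative (Mathlib
`Complex.norm_iteratedDeriv_le_of_forall_mem_sphere_norm_le`) and the tree's flow lemma `hasDerivAt_comp_mul_exp` give
`HessBoundOn F X (2M/r²)` — the input of the §1 exchange lemma `hessBound_sum_of_local`. -/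

section Exch2

/-- **Cauchy transfer, one real variable.**  If `f : ℝ → ℝ` agrees on `(-r, r)` with a function `G` complex-differentiable on
the disc of radius `r` and bounded by `M` on its boundary circle, then `|f''(0)| ≤ 2M/r²` (here `f'' (0) = f₂` is presented
through `HasDerivAt` data, as the tree's flow lemmas produce it). [folklore] -/
theorem abs_le_of_complex_extension {f f₁ : ℝ → ℝ} {f₂ : ℝ} {G : ℂ → ℂ} {M r : ℝ} (hr : 0 < r)
    (hG : DiffContOnCl ℂ G (Metric.ball 0 r)) (hM : ∀ z ∈ Metric.sphere (0 : ℂ) r, ‖G z‖ ≤ M)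
    (hGf : ∀ s : ℝ, |s| < r → G s = f s)
    (hf : ∀ s, HasDerivAt f (f₁ s) s) (hf₁ : HasDerivAt f₁ f₂ 0) :
    |f₂| ≤ 2 * M / r ^ 2 := by
  have hGd : DifferentiableOn ℂ G (Metric.ball 0 r) := hG.differentiableOn
  have hball : ∀ s : ℝ, |s| < r → (s : ℂ) ∈ Metric.ball (0 : ℂ) r := fun s hs => by
    rw [Metric.mem_ball, dist_zero_right, Complex.norm_real, Real.norm_eq_abs]; exact hs
  have hopen : IsOpen {y : ℝ | |y| < r} := isOpen_lt continuous_abs continuous_const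
  have hr0 : |(0 : ℝ)| < r := by simpa using hr
  have h1 : ∀ s : ℝ, |s| < r → deriv G (s : ℂ) = ((f₁ s : ℝ) : ℂ) := by
    intro s hs
    have hA : HasDerivAt (fun y : ℝ => G y) (deriv G s) s :=
      ((hGd.differentiableAt (Metric.isOpen_ball.mem_nhds (hball s hs))).hasDerivAt).comp_ofReal
    have hev : (fun y : ℝ => G y) =ᶠ[𝓝 s] (fun y : ℝ => ((f y : ℝ) : ℂ)) := by
      filter_upwards [hopen.mem_nhds hs] with y hy using hGf y hy
    have hB : HasDerivAt (fun y : ℝ => G y) ((f₁ s : ℝ) : ℂ) s :=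
      (hf s).ofReal_comp.congr_of_eventuallyEq hev
    exact hA.unique hB
  have h2 : deriv (deriv G) (0 : ℂ) = ((f₂ : ℝ) : ℂ) := by
    have hGd' : DifferentiableOn ℂ (deriv G) (Metric.ball 0 r) := hGd.deriv Metric.isOpen_ball
    have h0 : ((0 : ℝ) : ℂ) ∈ Metric.ball (0 : ℂ) r := hball 0 hr0
    have hA : HasDerivAt (fun y : ℝ => deriv G y) (deriv (deriv G) ((0 : ℝ) : ℂ)) 0 :=
      ((hGd'.differentiableAt (Metric.isOpen_ball.mem_nhds h0)).hasDerivAt).comp_ofReal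
    have hev : (fun y : ℝ => deriv G y) =ᶠ[𝓝 (0 : ℝ)] (fun y : ℝ => ((f₁ y : ℝ) : ℂ)) := by
      filter_upwards [hopen.mem_nhds hr0] with y hy using h1 y hy
    have hB : HasDerivAt (fun y : ℝ => deriv G y) ((f₂ : ℝ) : ℂ) 0 :=
      hf₁.ofReal_comp.congr_of_eventuallyEq hev
    have := hA.unique hB
    simpa using this
  have hC := Complex.norm_iteratedDeriv_le_of_forall_mem_sphere_norm_le 2 hr hG hM
  rw [iteratedDeriv_succ, iteratedDeriv_one, h2, Complex.norm_real, Real.norm_eq_abs] at hC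
  have h2f : ((Nat.factorial 2 : ℕ) : ℝ) = 2 := by norm_num [Nat.factorial]
  rw [h2f] at hC
  exact hC

variable {ι : Type u} [Fintype ι] [DecidableEq ι] {N : ℕ}

omit [Fintype ι] [DecidableEq ι] in
/-- `‖t X‖_F = |t| ‖X‖_F` for real `t`. [folklore] -/
private theorem frobNorm_real_smul (t : ℝ) (X : Matrix (Fin N) (Fin N) ℂ) : frobNorm (t • X) = |t| * frobNorm X := by
  rw [frobNorm_eq_norm, frobNorm_eq_norm, norm_smul, Real.norm_eq_abs]

-- `algD_algD_smul_dir` (homogeneity `D_{cA} D_{cA} F = c² D_A D_A F`) is the tree's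
-- `Summit.Ventures.YMGap.LatticeBakryEmery.algD_algD_smul_dir` (Thresholds/LatticeBakryEmeryPolarisation.lean, p401583), in scope via
-- `open Summit.Ventures.YMGap.LatticeBakryEmery`; not re-declared here per the gate's dedup rule.

/-- **Bałaban's analyticity format, typed** (localised on `X`, Hilbert–Schmidt-normalised directions): for every
`Q ∈ SU(N)^ι` and every `V ∈ 𝔰𝔲(N)^ι` with `Σ_{e∈X} ‖V_e‖_F² ≤ 1`, the function `s ↦ F(Q e^{sV})` is the restriction to
`(-r, r)` of a function complex-differentiable on the disc `|s| < r`, continuous on its closure and bounded by `M` on the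
circle `|s| = r`.  (For a term `E(X)` analytic and bounded by `M_X` on a complex strip of width `r` around `SU(N)^X` in every
link of `X` — Bałaban CMP 109 (1987) (1.18)–(1.22) — this holds with the same `M_X` and comparable `r`.) [folklore] -/
@[folklore]
def StripBoundOn (F : Cfg ι N → ℝ) (X : Finset ι) (M r : ℝ) : Prop :=
  ∀ (g : PSU ι N) (V : Cfg ι N), (∀ e, (V e)ᴴ = -V e) → (∀ e, (V e).trace = 0) →
    ∑ e ∈ X, frobNorm (V e) ^ 2 ≤ 1 →
    ∃ G : ℂ → ℂ, DiffContOnCl ℂ G (Metric.ball 0 r) ∧ (∀ z ∈ Metric.sphere (0 : ℂ) r, ‖G z‖ ≤ M) ∧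
      ∀ s : ℝ, |s| < r → G s = F (emb g * NormedSpace.exp (s • V))

omit [DecidableEq ι] in
/-- ★★ **EXCH-2 (E1) TYPED AND PROVED: analyticity format ⇒ localised Hessian bound `HessBoundOn F X (2M/r²)`.**
Cauchy's estimate for the second derivative along one-parameter subgroups + homogeneity; the case of a direction
vanishing on `X` is handled by scaling (`t ↦ tV` stays admissible for every `t`). [folklore] -/
theorem hessBoundOn_of_stripBoundOn {F : Cfg ι N → ℝ} (hF : ContDiff ℝ ∞ F) {X : Finset ι} {M r : ℝ} (hr : 0 < r)
    (hSB : StripBoundOn F X M r) : HessBoundOn F X (2 * M / r ^ 2) := by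
  -- Step A: the normalised estimate
  have hA : ∀ (g : PSU ι N) (V : Cfg ι N), (∀ e, (V e)ᴴ = -V e) → (∀ e, (V e).trace = 0) →
      ∑ e ∈ X, frobNorm (V e) ^ 2 ≤ 1 → |algD V (algD V F) (emb g)| ≤ 2 * M / r ^ 2 := by
    intro g V hV hV0 hn
    obtain ⟨G, hG, hGM, hGF⟩ := hSB g V hV hV0 hn
    have hf : ∀ s, HasDerivAt (fun s : ℝ => F (emb g * NormedSpace.exp (s • V)))
        (algD V F (emb g * NormedSpace.exp (s • V))) s := fun s => hasDerivAt_comp_mul_exp hF (emb g) V s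
    have hf₁ : HasDerivAt (fun s : ℝ => algD V F (emb g * NormedSpace.exp (s • V)))
        (algD V (algD V F) (emb g)) 0 := by
      have := hasDerivAt_comp_mul_exp (contDiff_algD hF V) (emb g) V 0
      rwa [zero_smul, NormedSpace.exp_zero, mul_one] at this
    exact abs_le_of_complex_extension hr hG hGM hGF hf hf₁
  intro g V hV hV0
  set c2 : ℝ := ∑ e ∈ X, frobNorm (V e) ^ 2 with hc2
  have hc2nn : 0 ≤ c2 := sum_nonneg fun e _ => sq_nonneg _
  have hskew : ∀ (t : ℝ) e, ((t • V) e)ᴴ = -(t • V) e := fun t e => by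
    simp only [Pi.smul_apply, Matrix.conjTranspose_smul, star_trivial, hV e, smul_neg]
  have htr : ∀ (t : ℝ) e, ((t • V) e).trace = 0 := fun t e => by
    simp only [Pi.smul_apply, Matrix.trace_smul, hV0 e, smul_zero]
  have hns : ∀ t : ℝ, ∑ e ∈ X, frobNorm ((t • V) e) ^ 2 = t ^ 2 * c2 := fun t => by
    simp only [Pi.smul_apply, frobNorm_real_smul, mul_pow, sq_abs]
    rw [← Finset.mul_sum]
  have hscale : ∀ t : ℝ, algD (t • V) (algD (t • V) F) (emb g) = t ^ 2 * algD V (algD V F) (emb g) :=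
    fun t => algD_algD_smul_dir hF t V (emb g)
  rcases hc2nn.eq_or_lt with hzero | hpos
  · -- directions invisible on `X`: every multiple is admissible, so the second derivative vanishes
    have hall : ∀ t : ℝ, t ^ 2 * |algD V (algD V F) (emb g)| ≤ 2 * M / r ^ 2 := by
      intro t
      have := hA g (t • V) (hskew t) (htr t) (by rw [hns t, ← hzero, mul_zero]; exact zero_le_one)
      rwa [hscale t, abs_mul, abs_of_nonneg (sq_nonneg t)] at this
    have hB0 : 0 ≤ 2 * M / r ^ 2 := by have := hall 0; simpa using this
    have hAz : |algD V (algD V F) (emb g)| = 0 := by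
      by_contra hne
      have hApos : 0 < |algD V (algD V F) (emb g)| := (abs_nonneg _).lt_of_ne (Ne.symm hne)
      have := hall (Real.sqrt ((2 * M / r ^ 2 + 1) / |algD V (algD V F) (emb g)|))
      rw [Real.sq_sqrt (div_nonneg (by linarith) hApos.le), div_mul_cancel₀ _ hApos.ne'] at this
      linarith
    rw [hAz, ← hzero, mul_zero]
  · -- normalise
    set c := Real.sqrt c2 with hc
    have hcpos : 0 < c := Real.sqrt_pos.2 hpos
    have hcsq : c ^ 2 = c2 := Real.sq_sqrt hc2nn
    have hVhat := hA g (c⁻¹ • V) (hskew c⁻¹) (htr c⁻¹)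
      (by rw [hns c⁻¹, inv_pow, hcsq, inv_mul_cancel₀ hpos.ne'])
    have hVeq : algD V (algD V F) (emb g) = c ^ 2 * algD (c⁻¹ • V) (algD (c⁻¹ • V) F) (emb g) := by
      have h := algD_algD_smul_dir hF c (c⁻¹ • V) (emb g)
      rwa [smul_inv_smul₀ hcpos.ne'] at h
    rw [hVeq, abs_mul, abs_of_nonneg (sq_nonneg c), hcsq]
    calc c2 * |algD (c⁻¹ • V) (algD (c⁻¹ • V) F) (emb g)| ≤ c2 * (2 * M / r ^ 2) :=
          mul_le_mul_of_nonneg_left hVhat hc2nn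
      _ = 2 * M / r ^ 2 * c2 := mul_comm _ _

omit [DecidableEq ι] in
/-- Global form (`X = univ`): `StripBoundOn F univ M r → HessBound F (2M/r²)`. [folklore] -/
theorem hessBound_of_stripBound {F : Cfg ι N → ℝ} (hF : ContDiff ℝ ∞ F) {M r : ℝ} (hr : 0 < r)
    (hSB : StripBoundOn F univ M r) : HessBound F (2 * M / r ^ 2) :=
  fun g V hV hV0 => hessBoundOn_of_stripBoundOn hF hr hSB g V hV hV0

/-- ★★ **THE EXCHANGE, END TO END**: a finite family of local terms in Bałaban's format (`E i` analytic with bound `M i` on a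
strip of width `r`, localised on `X i`) has global Hessian constant at most the PER-LINK LOAD `sup_e Σ_{i : e ∈ X i} 2M_i/r²`
— intensive, never the (extensive) total. [folklore] -/
theorem hessBound_sum_of_strip {κ : Type*} (s : Finset κ) {E : κ → Cfg ι N → ℝ} (hE : ∀ i, ContDiff ℝ ∞ (E i))
    {X : κ → Finset ι} {M : κ → ℝ} {r : ℝ} (hr : 0 < r) (hSB : ∀ i ∈ s, StripBoundOn (E i) (X i) (M i) r)
    {η : ℝ} (hη : ∀ e, hessLoad s X (fun i => 2 * M i / r ^ 2) e ≤ η) : HessBound (∑ i ∈ s, E i) η :=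
  hessBound_sum_of_local s hE (fun i hi => hessBoundOn_of_stripBoundOn (hE i) hr (hSB i hi)) hη

end Exch2

/-! ## ── part 09 · `Polarisation` — §5b both door inputs from ONE strip datum, over the tree's `Thresholds/LatticeBakryEmeryPolarisation.lean` ── -/

section PolarisationBridge

variable {ι : Type u} [Fintype ι] [DecidableEq ι] {N : ℕ}

/-- ★★ **BOTH DOOR INPUTS FROM ONE STRIP DATUM**: `StripBoundOn F X M r ⇒ OffDiagHessBound F (4M/r²·1_{e,e'∈X})`. [folklore] -/
theorem offDiagHessBound_of_stripBoundOn {F : Cfg ι N → ℝ} (hF : ContDiff ℝ ∞ F) {X : Finset ι} {M r : ℝ} (hr : 0 < r)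
    (hM : 0 ≤ M) (hSB : StripBoundOn F X M r) :
    OffDiagHessBound F (fun e e' => if e ∈ X ∧ e' ∈ X then 2 * (2 * M / r ^ 2) else 0) :=
  offDiagHessBound_of_hessBoundOn hF (by positivity) (hessBoundOn_of_stripBoundOn hF hr hSB)

end PolarisationBridge

/-! ## ── part 10 · `C2Density` — §4e D1 as an ADAPTER to the tree's `Thresholds/LatticeBakryEmeryC2Density.lean` ── -/

section C2DensityAdapter

variable {ι : Type u} [Fintype ι] [DecidableEq ι] {N : ℕ}

/-- ★★★ **D1: every `C^∞` ambient potential is C²-approximable by polynomials in the tree's currency** (`C2PolyApprox S`), from the tree's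
`LatticeBakryEmery.c2PolyApprox_of_contDiff`. [folklore] -/
theorem c2PolyApprox_of_contDiff {S : Cfg ι N → ℝ} (hS : ContDiff ℝ ∞ S) : C2PolyApprox S :=
  fun _ hε => LatticeBakryEmery.c2PolyApprox_of_contDiff hS hε

end C2DensityAdapter

end Summit.Ventures.YMGap.BEDoor
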